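import Literature.Topology.FourManifolds.WrinkledFibrationMoveModels
import HarnessLib

/-!
# The indefinite cusp `(t, x, y, z) ↦ (t, x³ + t x + y² - z²)`: critical curve and cusped image

Topic `Literature/Topology/FourManifolds`.  The real normal form of a CUSP point of a generic
map from a 4-manifold to a surface (Baykur–Saeki 2017, §2.1, p. 6: *"a cusp singularity if
the map is locally given by `(t, x₁, x₂, x₃) ↦ (t, x₁³ + t x₁ ± x₂² ± x₃²)`. A fold or a cusp
point is definite if coefficients of all quadratic terms … are of the same sign, indefinite
otherwise. Note that an indefinite cusp is always adjacent to indefinite fold arcs."*), with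
the mixed signs `(+, -)`, as the suspended family (`WrinkledFibrationMoveModels.lean`) of
`g(t, x) = x³ + t x`.  Generic maps (only fold and cusp singularities) are the input of
Baykur–Saeki's construction of simplified broken Lefschetz fibrations (ibid. Thm. 6.1), and the
moves of that construction create and cancel cusps; this file supplies the model-level facts
about the cusp, all PROVED, no named fact:

* `indefiniteCuspMap`, `contDiff_indefiniteCuspMap`;
* `surjective_fderiv_indefiniteCuspMap_iff` — **the differential is onto iff
  `(3x² + t, y, z) ≠ 0`** (the general `surjective_fderiv_suspendedMap_iff` at `∂ₓ g = 3x² + t`),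
  so the critical set is the smooth curve `u ↦ (-3u², u, 0, 0)`
  (`not_surjective_fderiv_indefiniteCuspMap_iff_exists`, `indefiniteCuspCurve`);
* `indefiniteCuspMap_indefiniteCuspCurve` — the critical image is the semicubical parabola
  `u ↦ (-3u², -2u³)` with its cusp at the origin, and
  `injOn_indefiniteCuspMap_setOf_not_surjective` — the model is injective on its critical set
  (the critical image is an embedded cusped arc).

## References

* R. İ. Baykur, O. Saeki, *Simplifying indefinite fibrations on 4-manifolds*, arXiv:1705.11169
  (Trans. AMS 376, 2023), §2.1. [BaykurSaeki2017]
-/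

noncomputable section

open scoped ContDiff
open Set Function

namespace Literature.Topology.FourManifolds

/-- Local notation: `𝔼 n` is the model Euclidean space `EuclideanSpace ℝ (Fin n)`. -/
local notation "𝔼 " n:arg => EuclideanSpace ℝ (Fin n)

/-! ### The model map -/

/-- **The indefinite cusp** `ℝ⁴ → ℝ²`, `(t, x, y, z) ↦ (t, x³ + t x + y² - z²)` (coordinates
`x 0 = t`, `x 1 = x`, `x 2 = y`, `x 3 = z`): the local model of an indefinite cusp point of a
generic map from a 4-manifold to a surface (Baykur–Saeki 2017, §2.1, signs `(+, -)`), as the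
suspended family of `g(t, x) = x³ + t x`. [cite: BaykurSaeki2017, §2.1] -/
def indefiniteCuspMap : 𝔼 4 → 𝔼 2 :=
  suspendedMap fun p => p.2 ^ 3 + p.1 * p.2

/-- First component of the cusp model: `t`. [folklore] -/
@[simp] theorem indefiniteCuspMap_apply_zero (x : 𝔼 4) : indefiniteCuspMap x 0 = x 0 := by
  simp [indefiniteCuspMap]

/-- Second component of the cusp model: `x³ + t x + y² - z²`. [folklore] -/
@[simp] theorem indefiniteCuspMap_apply_one (x : 𝔼 4) :
    indefiniteCuspMap x 1 = x 1 ^ 3 + x 0 * x 1 + x 2 ^ 2 - x 3 ^ 2 := by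
  simp [indefiniteCuspMap]

/-- The cusp model is smooth (a polynomial map). [folklore] -/
theorem contDiff_indefiniteCuspMap : ContDiff ℝ ∞ indefiniteCuspMap :=
  contDiff_suspendedMap ((contDiff_snd.pow 3).add (contDiff_fst.mul contDiff_snd))

/-! ### The critical set is the curve `t = -3x²`, `y = z = 0` -/

/-- **The differential of the cusp model is onto iff `(3x₁² + x₀, x₂, x₃) ≠ 0`** — the
suspended-family criterion `surjective_fderiv_suspendedMap_iff` with `∂ₓ g = 3x² + t`.
[folklore] -/
theorem surjective_fderiv_indefiniteCuspMap_iff (x : 𝔼 4) :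
    Surjective (fderiv ℝ indefiniteCuspMap x) ↔ ¬ (3 * x 1 ^ 2 + x 0 = 0 ∧ x 2 = 0 ∧ x 3 = 0) := by
  obtain ⟨g', hg, hval⟩ : ∃ g' : ℝ × ℝ →L[ℝ] ℝ,
      HasFDerivAt (fun p : ℝ × ℝ => p.2 ^ 3 + p.1 * p.2) g' (x 0, x 1) ∧
        g' (0, 1) = 3 * x 1 ^ 2 + x 0 :=
    ⟨_, (hasFDerivAt_snd.pow 3).add (hasFDerivAt_fst.mul hasFDerivAt_snd), by simp⟩
  rw [indefiniteCuspMap, surjective_fderiv_suspendedMap_iff hg, hval]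

/-- **The critical curve of the cusp model**, `u ↦ (-3u², u, 0, 0)`: a smooth embedded curve
through the origin (the cusp point). [folklore] -/
def indefiniteCuspCurve (u : ℝ) : 𝔼 4 :=
  WithLp.toLp 2 ![-(3 * u ^ 2), u, 0, 0]

/-- Coordinates of the critical curve: `t = -3u²`. [folklore] -/
@[simp] theorem indefiniteCuspCurve_apply_zero (u : ℝ) :
    indefiniteCuspCurve u 0 = -(3 * u ^ 2) := by
  simp [indefiniteCuspCurve]

/-- Coordinates of the critical curve: `x = u`. [folklore] -/
@[simp] theorem indefiniteCuspCurve_apply_one (u : ℝ) : indefiniteCuspCurve u 1 = u := by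
  simp [indefiniteCuspCurve]

/-- Coordinates of the critical curve: `y = 0`. [folklore] -/
@[simp] theorem indefiniteCuspCurve_apply_two (u : ℝ) : indefiniteCuspCurve u 2 = 0 := by
  simp [indefiniteCuspCurve]

/-- Coordinates of the critical curve: `z = 0`. [folklore] -/
@[simp] theorem indefiniteCuspCurve_apply_three (u : ℝ) : indefiniteCuspCurve u 3 = 0 := by
  simp [indefiniteCuspCurve]

/-- The critical curve passes through the origin at `u = 0` (the cusp point). [folklore] -/
@[simp] theorem indefiniteCuspCurve_zero : indefiniteCuspCurve 0 = 0 := by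
  ext i
  fin_cases i <;> simp

/-- The critical curve is injective (its `x`-coordinate is the parameter). [folklore] -/
theorem injective_indefiniteCuspCurve : Injective indefiniteCuspCurve := fun u u' h => by
  simpa using congrArg (fun x : 𝔼 4 => x 1) h

/-- **The critical set of the cusp model is exactly the critical curve**: `dC_x` fails to be
onto iff `x = (-3u², u, 0, 0)` for some (unique) `u`, namely `u = x₁`. [folklore] -/
theorem not_surjective_fderiv_indefiniteCuspMap_iff_exists (x : 𝔼 4) :
    ¬ Surjective (fderiv ℝ indefiniteCuspMap x) ↔ ∃ u, x = indefiniteCuspCurve u := by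
  rw [surjective_fderiv_indefiniteCuspMap_iff, not_not]
  constructor
  · rintro ⟨h1, h2, h3⟩
    refine ⟨x 1, ?_⟩
    ext i
    fin_cases i
    · simp
      linarith
    · simp
    · simpa using h2
    · simpa using h3
  · rintro ⟨u, rfl⟩
    simp

/-- Every point of the critical curve is a critical point of the cusp model. [folklore] -/
theorem not_surjective_fderiv_indefiniteCuspMap_indefiniteCuspCurve (u : ℝ) :
    ¬ Surjective (fderiv ℝ indefiniteCuspMap (indefiniteCuspCurve u)) :=
  (not_surjective_fderiv_indefiniteCuspMap_iff_exists _).mpr ⟨u, rfl⟩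

/-! ### The critical image: the semicubical cusp `u ↦ (-3u², -2u³)` -/

/-- **The critical image of the cusp model is the semicubical parabola**: the critical curve
maps to `u ↦ (-3u², -2u³)`, with the cusp at the origin (`u = 0`). [folklore] -/
theorem indefiniteCuspMap_indefiniteCuspCurve (u : ℝ) :
    indefiniteCuspMap (indefiniteCuspCurve u) = WithLp.toLp 2 ![-(3 * u ^ 2), -(2 * u ^ 3)] := by
  ext i
  fin_cases i
  · simp
  · simp
    ring

/-- Second coordinate of the critical value: `-2u³`. [folklore] -/
theorem indefiniteCuspMap_indefiniteCuspCurve_apply_one (u : ℝ) :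
    indefiniteCuspMap (indefiniteCuspCurve u) 1 = -(2 * u ^ 3) := by
  rw [indefiniteCuspMap_indefiniteCuspCurve]
  simp

/-- **The cusp model is injective on its critical curve** (the critical value `(-3u², -2u³)`
determines `u` through the odd function `u³`): the critical image is an embedded cusped arc,
as required of the round image of a generic map near a cusp. [folklore] -/
theorem injective_indefiniteCuspMap_comp_indefiniteCuspCurve :
    Injective (indefiniteCuspMap ∘ indefiniteCuspCurve) := by
  intro u u' h
  have h1 : -(2 * u ^ 3) = -(2 * u' ^ 3) := by
    rw [← indefiniteCuspMap_indefiniteCuspCurve_apply_one,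
      ← indefiniteCuspMap_indefiniteCuspCurve_apply_one]
    exact congrArg (fun w : 𝔼 2 => w 1) h
  have h2 : u ^ 3 = u' ^ 3 := by linarith
  exact (Odd.strictMono_pow (by decide : Odd 3)).injective h2

/-- The cusp model is injective on its critical set `{x | dC_x not onto}`. [folklore] -/
theorem injOn_indefiniteCuspMap_setOf_not_surjective :
    InjOn indefiniteCuspMap {x | ¬ Surjective (fderiv ℝ indefiniteCuspMap x)} := by
  intro x hx x' hx' h
  obtain ⟨u, rfl⟩ := (not_surjective_fderiv_indefiniteCuspMap_iff_exists x).mp hx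
  obtain ⟨u', rfl⟩ := (not_surjective_fderiv_indefiniteCuspMap_iff_exists x').mp hx'
  rw [injective_indefiniteCuspMap_comp_indefiniteCuspCurve h]

end Literature.Topology.FourManifolds

end
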